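import Literature.NumberTheory.Connes2026.AnnulusCorrectionDiagonal
import Literature.NumberTheory.Connes2026.AnnulusGeometricResummation
import Mathlib.Analysis.Normed.Group.Tannery
import HarnessLib

/-!
# Connes 1999 Thm VII.4, `k = ℚ`, `S = {∞, p}` — THE LIMIT OF THE ANNULUS CORRECTION AND THE `P = {p}` CASE
# OF `Connes1999_thm_VII_4_rat`, REDUCED TO THE ONE-PARAMETER FAMILY `P̂⁰_M Q₀(1) ϑ_{m log p}`

LABEL (line 1): RH-FREE literature (theorems only; NO definition, NO named fact).  bears_on: LADDER-RH
W-C/W-P (C1 named-fact debt), cell `rh-crit`, sub-cell cc, overflow row O1 — green layer under the row's last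
named fact `Connes1999_thm_VII_4_rat` (the cases `P ≠ ∅`), tenth file of the "annulus road".  WHAT THIS IS
NOT: any claim about positivity, Weil's criterion or RH; nothing here bears on the truth of RH.

Sources.  A. Connes, Selecta Math. 5 (1999) [`Connes1999`], §VII Thm 4 and its proof (29)–(33) (held text
`paper:arxiv-math_9811068`, p0013); M. Reed, B. Simon (1972) [`ReedSimon1972`], Thm. VI.24.

## What is proved

Notation as in `AnnulusCorrectionDiagonal`: `τ₀ = log p`, `Y_M(m) = P̂⁰_M Q₀(1) ϑ_{mτ₀}`,
`d_g(A, e) = ⟨e, ϑ(g) A e⟩`, `K(Λ) = u_p^* P_Λ u_p − P_Λ`.  THREE properties of the one-parameter family —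
  (W0) the diagonal series `Σ_i d_g(Y_M(m), f_i)` has the same sum along all Hilbert bases of `L²(ℝ)_ev`;
  (W1) it is absolutely summable with `Σ_i |d_g(Y_M(m), f_i)| ≤ C`, `C` uniform in `M`, `m`, `(f_i)`;
  (W2) `Σ_i d_g(Y_M(m), f_i) → log p · g(−mτ₀)` as `M → ∞`
(which the Hilbert–Schmidt analysis of `ϑ(g) P̂⁰_M Q₀(1)` is to supply: `HilbertSchmidtPairing`,
`SemilocalCutoffLimits`, `SemilocalCutoffScaleInvariance`) — imply:

* `connesLocalTerm_comp_neg` — `connesLocalTerm p (g ∘ neg) = connesLocalTerm p g`;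
* **`tsum_diagCoeff_cutoffCorrection_singleton_eq`** — for `Λ > 0` and every Hilbert basis `(f_i)` of `L²(ℝ)_ev`:
  `Σ_i d_g(P̂⁰_Λ K(Λ), f_i) = Σ_{(a,b)} ((1 − p⁻¹) p^{−(a+b)/2}) Σ_i d_g(Y_{Λ²p^a}(a − b), f_i) − Σ_i d_g(Y_{Λ²}(0), f_i)`;
* **`tendsto_tsum_diagCoeff_cutoffCorrection_singleton`** — hypothesis `hlim` of the door at `P = {p}`:
  `Σ_i d_g(P̂⁰_Λ K(Λ), f_i) → connesLocalTerm p g = ∫′_{ℚ_p^*} h(u⁻¹)|u|^{1/2} d^*u` as `Λ → ∞`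
  (Tannery over `(a,b)` with the majorant `2 p^{−(a+b)/2} C`, then `AnnulusGeometricResummation`);
* **`Connes1999_thm_VII_4_rat_singleton_of_family`** — the conclusion of `Connes1999_thm_VII_4_rat` at
  `P = {p}`, for a Weil test function `g`, from (W0)–(W2), via the door `Connes1999_thm_VII_4_rat_at_of_annulusCorrection`.

No instance, notation or attribute; no `def`.
-/

noncomputable section

open _root_.MeasureTheory Complex Set Filter
open scoped Real Topology ComplexConjugate ENNReal InnerProductSpace

namespace Literature.NumberTheory.Connes2026

open Literature.NumberTheory.LFunctions Literature.Analysis.OperatorTheory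
open Literature.NumberTheory.ConnesConsani
open Literature.NumberTheory.ConnesConsani2024
open Literature.NumberTheory.ConnesConsani2021 hiding cutoffProj cutoffProj_coeFn

/-- `connesLocalTerm` is even in `g`: `∫′_{ℚ_p^*}` of `g(−·)` equals that of `g`. [cite: Connes1999, §VII Thm 4 (arXiv p0013)] -/
theorem connesLocalTerm_comp_neg (p : ℕ) (g : ℝ → ℂ) :
    connesLocalTerm p (fun x => g (-x)) = connesLocalTerm p g := by
  unfold connesLocalTerm
  refine tsum_congr fun m => ?_
  simp only [neg_neg]
  ring

variable (p : ℕ) [hp : Fact p.Prime]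

section Limit

variable {g : ℝ → ℂ} {C : ℝ}

/-- **The diagonal series of `P̂⁰_Λ K(Λ)` in terms of the one-parameter family** (`Λ > 0`): under (W0), (W1),
`Σ_i d_g(P̂⁰_Λ K(Λ), f_i) = Σ_{(a,b)} w_{ab} Σ_i d_g(Y_{Λ²p^a}(a−b), f_i) − Σ_i d_g(Y_{Λ²}(0), f_i)`,
`w_{ab} = (1 − p⁻¹) p^{−(a+b)/2}`. [cite: Connes1999, §VII proof of Thm 4 eqs. (29)–(33) (arXiv p0013); ReedSimon1972, Thm. VI.24, PDF p. 199] -/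
theorem tsum_diagCoeff_cutoffCorrection_singleton_eq
    (hW0 : ∀ (M : ℝ) (m : ℤ) (ι : Type)
      (f : HilbertBasis ι ℂ (evenPart : Submodule ℂ (Lp ℂ 2 (volume : Measure ℝ)))) (ι' : Type)
      (f' : HilbertBasis ι' ℂ (evenPart : Submodule ℂ (Lp ℂ 2 (volume : Measure ℝ)))),
      ∑' i, diagCoeff g (dualCutoffProj ∅ M * annulusProj p 1 * scalingUnitary (m * Real.log p))
          ((f i : evenPart) : Lp ℂ 2 (volume : Measure ℝ)) =
        ∑' i, diagCoeff g (dualCutoffProj ∅ M * annulusProj p 1 * scalingUnitary (m * Real.log p))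
          ((f' i : evenPart) : Lp ℂ 2 (volume : Measure ℝ)))
    (hW1 : ∀ (M : ℝ) (m : ℤ) (ι : Type)
      (f : HilbertBasis ι ℂ (evenPart : Submodule ℂ (Lp ℂ 2 (volume : Measure ℝ)))),
      Summable (fun i => ‖diagCoeff g (dualCutoffProj ∅ M * annulusProj p 1 * scalingUnitary (m * Real.log p))
        ((f i : evenPart) : Lp ℂ 2 (volume : Measure ℝ))‖) ∧
      ∑' i, ‖diagCoeff g (dualCutoffProj ∅ M * annulusProj p 1 * scalingUnitary (m * Real.log p))
        ((f i : evenPart) : Lp ℂ 2 (volume : Measure ℝ))‖ ≤ C)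
    (ι : Type) (f : HilbertBasis ι ℂ (evenPart : Submodule ℂ (Lp ℂ 2 (volume : Measure ℝ))))
    {Λ : ℝ} (hΛ : 0 < Λ) :
    ∑' i, diagCoeff g (dualCutoffProj ∅ Λ *
        (ContinuousLinearMap.adjoint (twistUnitary {p}) * cutoffProj Λ * twistUnitary {p} - cutoffProj Λ))
        ((f i : evenPart) : Lp ℂ 2 (volume : Measure ℝ)) =
      (∑' ab : ℕ × ℕ, ((1 - (p : ℂ)⁻¹) * (((Real.sqrt p)⁻¹ : ℝ) : ℂ) ^ (ab.1 + ab.2)) *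
        ∑' i, diagCoeff g (dualCutoffProj ∅ (Λ ^ 2 * (p : ℝ) ^ ab.1) * annulusProj p 1 *
            scalingUnitary ((((ab.1 : ℤ) - ab.2 : ℤ) : ℝ) * Real.log p))
          ((f i : evenPart) : Lp ℂ 2 (volume : Measure ℝ))) -
      ∑' i, diagCoeff g (dualCutoffProj ∅ (Λ ^ 2) * annulusProj p 1 * scalingUnitary (((0 : ℤ) : ℝ) * Real.log p))
          ((f i : evenPart) : Lp ℂ 2 (volume : Measure ℝ)) := by
  have hC : 0 ≤ C := by
    obtain ⟨-, h2⟩ := hW1 1 0 ι f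
    exact (tsum_nonneg fun _ => norm_nonneg _).trans h2
  -- weights
  set r : ℝ := (Real.sqrt p)⁻¹ with hr
  have hr0 : 0 ≤ r := inv_nonneg.mpr (Real.sqrt_nonneg _)
  have hr1 : r < 1 := by
    rw [hr, inv_lt_one_iff₀]; right
    rw [show (1 : ℝ) = Real.sqrt 1 by simp]
    exact Real.sqrt_lt_sqrt zero_le_one (by exact_mod_cast hp.out.one_lt)
  set w : ℕ × ℕ → ℂ := fun ab => (1 - (p : ℂ)⁻¹) * ((r : ℝ) : ℂ) ^ (ab.1 + ab.2) with hw
  have hwn : ∀ ab : ℕ × ℕ, ‖w ab‖ ≤ 2 * (r ^ ab.1 * r ^ ab.2) := fun ab => by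
    rw [hw]
    simp only
    rw [norm_mul, norm_pow, Complex.norm_real, Real.norm_eq_abs, abs_of_nonneg hr0, pow_add]
    refine mul_le_mul_of_nonneg_right ?_ (mul_nonneg (pow_nonneg hr0 _) (pow_nonneg hr0 _))
    calc ‖(1 : ℂ) - (p : ℂ)⁻¹‖ ≤ ‖(1 : ℂ)‖ + ‖(p : ℂ)⁻¹‖ := norm_sub_le _ _
      _ ≤ 1 + 1 := by
          rw [norm_one, norm_inv, Complex.norm_natCast]
          gcongr
          exact inv_le_one_of_one_le₀ (by exact_mod_cast hp.out.one_lt.le)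
      _ = 2 := by norm_num
  have hwsum : Summable fun ab : ℕ × ℕ => 2 * (r ^ ab.1 * r ^ ab.2) :=
    ((summable_geometric_of_lt_one hr0 hr1).mul_of_nonneg (summable_geometric_of_lt_one hr0 hr1)
      (fun _ => pow_nonneg hr0 _) (fun _ => pow_nonneg hr0 _)).mul_left 2
  -- the terms and the one-parameter sums
  set D : ℕ × ℕ → ι → ℂ := fun ab i => diagCoeff g (dualCutoffProj ∅ Λ *
    (scalingUnitary (ab.1 * Real.log p) * annulusProj p Λ * scalingUnitary (ab.2 * (-Real.log p))))
    ((f i : evenPart) : Lp ℂ 2 (volume : Measure ℝ)) with hD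
  set S : ℕ × ℕ → ℂ := fun ab => ∑' i, diagCoeff g (dualCutoffProj ∅ (Λ ^ 2 * (p : ℝ) ^ ab.1) * annulusProj p 1 *
      scalingUnitary ((((ab.1 : ℤ) - ab.2 : ℤ) : ℝ) * Real.log p)) ((f i : evenPart) : Lp ℂ 2 (volume : Measure ℝ))
    with hS
  have hcast : ∀ ab : ℕ × ℕ, (((ab.1 : ℤ) - ab.2 : ℤ) : ℝ) = (ab.1 : ℝ) - ab.2 := fun ab => by push_cast; ring
  -- rows: `Σ_i D ab i = S ab` (transport the basis back by (W0)) and the absolute bound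
  have hDrow : ∀ ab : ℕ × ℕ, (Summable (fun i => ‖D ab i‖) ∧ ∑' i, ‖D ab i‖ ≤ C) ∧ HasSum (fun i => D ab i) (S ab) :=
    fun ab => by
    have h1 := hW1 (Λ ^ 2 * (p : ℝ) ^ ab.1) ((ab.1 : ℤ) - ab.2) ι (f.scalingConj (Real.log Λ + ab.1 * Real.log p))
    have h0 := hW0 (Λ ^ 2 * (p : ℝ) ^ ab.1) ((ab.1 : ℤ) - ab.2) ι
      (f.scalingConj (Real.log Λ + ab.1 * Real.log p)) ι f
    rw [hcast] at h1 h0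
    have hDeq : ∀ i, D ab i = diagCoeff g (dualCutoffProj ∅ (Λ ^ 2 * (p : ℝ) ^ ab.1) * annulusProj p 1 *
        scalingUnitary (((ab.1 : ℝ) - ab.2) * Real.log p))
        ((f.scalingConj (Real.log Λ + ab.1 * Real.log p) i : evenPart) : Lp ℂ 2 (volume : Measure ℝ)) :=
      fun i => by rw [hD]; exact diagCoeff_dualCutoffProj_annulusTerm p g hΛ ab.1 ab.2 f i
    simp_rw [hDeq]
    refine ⟨h1, ?_⟩
    rw [hS]
    simp only
    rw [hcast, ← h0]
    exact (Summable.of_norm h1.1).hasSum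
  -- joint summability over `(ℕ × ℕ) × ι` of `w ab * D ab i`
  have hG : Summable fun abi : (ℕ × ℕ) × ι => ‖w abi.1‖ * ‖D abi.1 abi.2‖ := by
    refine (summable_prod_of_nonneg fun _ => mul_nonneg (norm_nonneg _) (norm_nonneg _)).2 ⟨fun ab => ?_, ?_⟩
    · exact ((hDrow ab).1.1.mul_left ‖w ab‖).congr fun i => rfl
    · refine Summable.of_nonneg_of_le (fun _ => tsum_nonneg fun _ => mul_nonneg (norm_nonneg _) (norm_nonneg _))
        (fun ab => ?_) (hwsum.mul_right C)
      simp only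
      rw [tsum_mul_left]
      exact mul_le_mul (hwn ab) (hDrow ab).1.2 (tsum_nonneg fun _ => norm_nonneg _)
        (mul_nonneg zero_le_two (mul_nonneg (pow_nonneg hr0 _) (pow_nonneg hr0 _)))
  have hF : Summable fun abi : (ℕ × ℕ) × ι => w abi.1 * D abi.1 abi.2 :=
    Summable.of_norm (hG.congr fun abi => (norm_mul _ _).symm)
  have hFs := hF.hasSum
  -- fibre over `ab`: `Σ_i w D = w S`; fibre over `i`: `Σ_ab w D = d(P̂ K) + d(P̂ Q₀)`
  have h1 : HasSum (fun ab : ℕ × ℕ => w ab * S ab) (∑' abi : (ℕ × ℕ) × ι, w abi.1 * D abi.1 abi.2) :=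
    hFs.prod_fiberwise fun ab => ((hDrow ab).2.mul_left (w ab))
  have h2 : HasSum (fun i => diagCoeff g (dualCutoffProj ∅ Λ *
        (ContinuousLinearMap.adjoint (twistUnitary {p}) * cutoffProj Λ * twistUnitary {p} - cutoffProj Λ))
        ((f i : evenPart) : Lp ℂ 2 (volume : Measure ℝ)) +
      diagCoeff g (dualCutoffProj ∅ Λ * annulusProj p Λ) ((f i : evenPart) : Lp ℂ 2 (volume : Measure ℝ)))
      (∑' abi : (ℕ × ℕ) × ι, w abi.1 * D abi.1 abi.2) := by
    have hFs' : HasSum (fun iab : ι × (ℕ × ℕ) => w iab.2 * D iab.2 iab.1)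
        (∑' abi : (ℕ × ℕ) × ι, w abi.1 * D abi.1 abi.2) :=
      (Equiv.prodComm ι (ℕ × ℕ)).hasSum_iff.mpr hFs
    exact hFs'.prod_fiberwise fun i =>
      hasSum_diagCoeff_cutoffCorrection_singleton p g Λ ((f i : evenPart) : Lp ℂ 2 (volume : Measure ℝ))
  -- the `Q₀` term along `f`
  have hQ0 : ∀ i, diagCoeff g (dualCutoffProj ∅ Λ * annulusProj p Λ) ((f i : evenPart) : Lp ℂ 2 (volume : Measure ℝ)) =
      diagCoeff g (dualCutoffProj ∅ (Λ ^ 2) * annulusProj p 1 * scalingUnitary ((0 : ℤ) * Real.log p))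
        ((f.scalingConj (Real.log Λ) i : evenPart) : Lp ℂ 2 (volume : Measure ℝ)) :=
    fun i => diagCoeff_dualCutoffProj_annulusProj p g hΛ f i
  have hQsum : Summable fun i => diagCoeff g (dualCutoffProj ∅ Λ * annulusProj p Λ)
      ((f i : evenPart) : Lp ℂ 2 (volume : Measure ℝ)) := by
    have h := (hW1 (Λ ^ 2) 0 ι (f.scalingConj (Real.log Λ))).1
    simp only [Int.cast_zero] at h
    refine (Summable.of_norm h).congr fun i => ?_
    rw [hQ0, Int.cast_zero]
  have hQval : ∑' i, diagCoeff g (dualCutoffProj ∅ Λ * annulusProj p Λ) ((f i : evenPart) : Lp ℂ 2 (volume : Measure ℝ)) =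
      ∑' i, diagCoeff g (dualCutoffProj ∅ (Λ ^ 2) * annulusProj p 1 * scalingUnitary (((0 : ℤ) : ℝ) * Real.log p))
        ((f i : evenPart) : Lp ℂ 2 (volume : Measure ℝ)) := by
    rw [hW0 (Λ ^ 2) 0 ι f ι (f.scalingConj (Real.log Λ))]
    exact tsum_congr fun i => by rw [hQ0, Int.cast_zero]
  -- conclude
  have hKsum : Summable fun i => diagCoeff g (dualCutoffProj ∅ Λ *
      (ContinuousLinearMap.adjoint (twistUnitary {p}) * cutoffProj Λ * twistUnitary {p} - cutoffProj Λ))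
      ((f i : evenPart) : Lp ℂ 2 (volume : Measure ℝ)) := by
    refine (h2.summable.sub hQsum).congr fun i => ?_
    simp only [add_sub_cancel_right]
  have htot := h2.tsum_eq
  rw [hKsum.tsum_add hQsum, ← h1.tsum_eq] at htot
  rw [← hQval, eq_sub_iff_add_eq, htot]

/-- **Hypothesis `hlim` of the door at `P = {p}` from (W0), (W1), (W2).**  If moreover
`Σ_i d_g(Y_M(m), f_i) → log p · g(−m log p)` as `M → ∞` for every `m ∈ ℤ` and every Hilbert basis, and `g` is
bounded, then `Σ_i d_g(P̂⁰_Λ K(Λ), f_i) → connesLocalTerm p g` as `Λ → ∞` (Tannery's theorem over `(a, b)` with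
the summable majorant `2 p^{−(a+b)/2} C`, the substitution `M = Λ² p^a → ∞`, and the resummation
`(1 − p⁻¹) Σ_{(a,b)} p^{−(a+b)/2} G(a − b) − G(0) = Σ_{m ≥ 1} p^{−m/2}(G(m) + G(−m))`, `G(m) = log p · g(−m log p)`). [cite: Connes1999, §VII Thm 4 and proof eqs. (29)–(33) (arXiv p0013)] -/
theorem tendsto_tsum_diagCoeff_cutoffCorrection_singleton {B : ℝ} (hgB : ∀ x, ‖g x‖ ≤ B)
    (hW0 : ∀ (M : ℝ) (m : ℤ) (ι : Type)
      (f : HilbertBasis ι ℂ (evenPart : Submodule ℂ (Lp ℂ 2 (volume : Measure ℝ)))) (ι' : Type)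
      (f' : HilbertBasis ι' ℂ (evenPart : Submodule ℂ (Lp ℂ 2 (volume : Measure ℝ)))),
      ∑' i, diagCoeff g (dualCutoffProj ∅ M * annulusProj p 1 * scalingUnitary (m * Real.log p))
          ((f i : evenPart) : Lp ℂ 2 (volume : Measure ℝ)) =
        ∑' i, diagCoeff g (dualCutoffProj ∅ M * annulusProj p 1 * scalingUnitary (m * Real.log p))
          ((f' i : evenPart) : Lp ℂ 2 (volume : Measure ℝ)))
    (hW1 : ∀ (M : ℝ) (m : ℤ) (ι : Type)
      (f : HilbertBasis ι ℂ (evenPart : Submodule ℂ (Lp ℂ 2 (volume : Measure ℝ)))),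
      Summable (fun i => ‖diagCoeff g (dualCutoffProj ∅ M * annulusProj p 1 * scalingUnitary (m * Real.log p))
        ((f i : evenPart) : Lp ℂ 2 (volume : Measure ℝ))‖) ∧
      ∑' i, ‖diagCoeff g (dualCutoffProj ∅ M * annulusProj p 1 * scalingUnitary (m * Real.log p))
        ((f i : evenPart) : Lp ℂ 2 (volume : Measure ℝ))‖ ≤ C)
    (hW2 : ∀ (m : ℤ) (ι : Type)
      (f : HilbertBasis ι ℂ (evenPart : Submodule ℂ (Lp ℂ 2 (volume : Measure ℝ)))),
      Tendsto (fun M : ℝ => ∑' i,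
          diagCoeff g (dualCutoffProj ∅ M * annulusProj p 1 * scalingUnitary (m * Real.log p))
            ((f i : evenPart) : Lp ℂ 2 (volume : Measure ℝ)))
        atTop (𝓝 ((Real.log p : ℂ) * g (-(m * Real.log p)))))
    (ι : Type) (f : HilbertBasis ι ℂ (evenPart : Submodule ℂ (Lp ℂ 2 (volume : Measure ℝ)))) :
    Tendsto (fun Λ : ℝ => ∑' i, diagCoeff g (dualCutoffProj ∅ Λ *
        (ContinuousLinearMap.adjoint (twistUnitary {p}) * cutoffProj Λ * twistUnitary {p} - cutoffProj Λ))
        ((f i : evenPart) : Lp ℂ 2 (volume : Measure ℝ)))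
      atTop (𝓝 (∑ q ∈ ({p} : Finset ℕ), connesLocalTerm q g)) := by
  have hp0 : (0 : ℝ) < p := by exact_mod_cast hp.out.pos
  have hC : 0 ≤ C := by
    obtain ⟨-, h2⟩ := hW1 1 0 ι f
    exact (tsum_nonneg fun _ => norm_nonneg _).trans h2
  set r : ℝ := (Real.sqrt p)⁻¹ with hr
  have hr0 : 0 ≤ r := inv_nonneg.mpr (Real.sqrt_nonneg _)
  have hr1 : r < 1 := by
    rw [hr, inv_lt_one_iff₀]; right
    rw [show (1 : ℝ) = Real.sqrt 1 by simp]
    exact Real.sqrt_lt_sqrt zero_le_one (by exact_mod_cast hp.out.one_lt)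
  set w : ℕ × ℕ → ℂ := fun ab => (1 - (p : ℂ)⁻¹) * ((r : ℝ) : ℂ) ^ (ab.1 + ab.2) with hw
  have hwn : ∀ ab : ℕ × ℕ, ‖w ab‖ ≤ 2 * (r ^ ab.1 * r ^ ab.2) := fun ab => by
    rw [hw]
    simp only
    rw [norm_mul, norm_pow, Complex.norm_real, Real.norm_eq_abs, abs_of_nonneg hr0, pow_add]
    refine mul_le_mul_of_nonneg_right ?_ (mul_nonneg (pow_nonneg hr0 _) (pow_nonneg hr0 _))
    calc ‖(1 : ℂ) - (p : ℂ)⁻¹‖ ≤ ‖(1 : ℂ)‖ + ‖(p : ℂ)⁻¹‖ := norm_sub_le _ _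
      _ ≤ 1 + 1 := by
          rw [norm_one, norm_inv, Complex.norm_natCast]
          gcongr
          exact inv_le_one_of_one_le₀ (by exact_mod_cast hp.out.one_lt.le)
      _ = 2 := by norm_num
  have hwsum : Summable fun ab : ℕ × ℕ => 2 * (r ^ ab.1 * r ^ ab.2) :=
    ((summable_geometric_of_lt_one hr0 hr1).mul_of_nonneg (summable_geometric_of_lt_one hr0 hr1)
      (fun _ => pow_nonneg hr0 _) (fun _ => pow_nonneg hr0 _)).mul_left 2
  -- the one-parameter sums along the fixed basis `f`
  set T : ℝ → ℤ → ℂ := fun M m => ∑' i,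
    diagCoeff g (dualCutoffProj ∅ M * annulusProj p 1 * scalingUnitary (m * Real.log p))
      ((f i : evenPart) : Lp ℂ 2 (volume : Measure ℝ)) with hT
  have hTb : ∀ M m, ‖T M m‖ ≤ C := fun M m => by
    obtain ⟨h1, h2⟩ := hW1 M m ι f
    exact (norm_tsum_le_tsum_norm h1).trans h2
  set L : ℤ → ℂ := fun m => (Real.log p : ℂ) * g (-(m * Real.log p)) with hL
  -- Step 1: the double series tends to `Σ_ab w_ab L(a − b)`
  have hlim1 : Tendsto (fun Λ : ℝ => ∑' ab : ℕ × ℕ, w ab * T (Λ ^ 2 * (p : ℝ) ^ ab.1) ((ab.1 : ℤ) - ab.2))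
      atTop (𝓝 (∑' ab : ℕ × ℕ, w ab * L ((ab.1 : ℤ) - ab.2))) := by
    refine tendsto_tsum_of_dominated_convergence (bound := fun ab => 2 * (r ^ ab.1 * r ^ ab.2) * C)
      (hwsum.mul_right C) (fun ab => ?_) (Eventually.of_forall fun Λ ab => ?_)
    · refine Tendsto.const_mul (w ab) ?_
      have hM : Tendsto (fun Λ : ℝ => Λ ^ 2 * (p : ℝ) ^ ab.1) atTop atTop :=
        (tendsto_pow_atTop two_ne_zero).atTop_mul_const (pow_pos hp0 _)
      exact (hW2 ((ab.1 : ℤ) - ab.2) ι f).comp hM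
    · rw [norm_mul]
      exact mul_le_mul (hwn ab) (hTb _ _) (norm_nonneg _)
        (mul_nonneg zero_le_two (mul_nonneg (pow_nonneg hr0 _) (pow_nonneg hr0 _)))
  -- Step 2: the `Q₀` term tends to `L 0`
  have hlim2 : Tendsto (fun Λ : ℝ => T (Λ ^ 2) 0) atTop (𝓝 (L 0)) := by
    have h := (hW2 0 ι f).comp (tendsto_pow_atTop (α := ℝ) two_ne_zero)
    simpa only [hT, hL, Int.cast_zero, Function.comp_def] using h
  -- Step 3: the value `Σ_ab w_ab L(a−b) − L 0 = connesLocalTerm p g`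
  have hval : ∑' ab : ℕ × ℕ, w ab * L ((ab.1 : ℤ) - ab.2) - L 0 = connesLocalTerm p g := by
    have h := hasSum_annulus_pair_connesLocalTerm (p := p) hp.out.two_le (fun x => g (-x)) (fun x => hgB (-x))
    have hsummand : ∀ ab : ℕ × ℕ, w ab * L ((ab.1 : ℤ) - ab.2) =
        ((1 - (p : ℝ)⁻¹) * (Real.sqrt p)⁻¹ ^ (ab.1 + ab.2)) •
          ((Real.log p : ℂ) * g (-((((ab.1 : ℤ) - ab.2 : ℤ) : ℝ) * Real.log p))) := fun ab => by
      rw [hw, hL, Complex.real_smul, hr]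
      push_cast
      ring
    simp_rw [hsummand]
    rw [h.tsum_eq, connesLocalTerm_comp_neg, hL]
    simp only [Int.cast_zero, zero_mul, neg_zero]
    ring
  -- Step 4: assemble (the formula holds for `Λ > 0`)
  rw [Finset.sum_singleton, ← hval]
  refine ((hlim1.sub hlim2).congr' ?_)
  filter_upwards [eventually_gt_atTop (0 : ℝ)] with Λ hΛ
  rw [tsum_diagCoeff_cutoffCorrection_singleton_eq p hW0 hW1 ι f hΛ]

end Limit

/-! ## The `P = {p}` case of `Connes1999_thm_VII_4_rat`, conditional on (W0)–(W2) -/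

section Singleton

/-- **Connes 1999 Thm VII.4 for `k = ℚ`, `S = {∞, p}` (`K_S`-invariant picture), reduced to the one-parameter
family.**  For a prime `p`, a Weil test function `g`, and the three properties (W0) basis-independence, (W1) a
uniform absolute bound, (W2) the limits `log p · g(−m log p)`, of the diagonal series of
`ϑ(g) P̂⁰_M Q₀(1) ϑ_{m log p}` along Hilbert bases of `L²(ℝ)_ev`: for every Hilbert basis `(e_i)` of
`L²(ℝ)_ev` the diagonal series of `ϑ(g) R_Λ^S` is summable for `Λ > 0` and
`Σ_i ⟨e_i, ϑ(g) R_Λ^S e_i⟩ = 2 log Λ · g(0) + connesLocalTerm p g + connesArchPV g + o(1)` — the conclusion of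
`Connes1999_thm_VII_4_rat` at `P = {p}` (door `Connes1999_thm_VII_4_rat_at_of_annulusCorrection` with
`hsum` from `AnnulusCorrectionDiagonal` and `hlim` from this file). [cite: Connes1999, §VII Thm 4 (arXiv p0013); Connes2026Letter, §7.4 (arXiv p0025:L16)] -/
theorem Connes1999_thm_VII_4_rat_singleton_of_family {g : ℝ → ℂ} (hg : IsWeilTest g) {C : ℝ}
    (hW0 : ∀ (M : ℝ) (m : ℤ) (ι : Type)
      (f : HilbertBasis ι ℂ (evenPart : Submodule ℂ (Lp ℂ 2 (volume : Measure ℝ)))) (ι' : Type)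
      (f' : HilbertBasis ι' ℂ (evenPart : Submodule ℂ (Lp ℂ 2 (volume : Measure ℝ)))),
      ∑' i, diagCoeff g (dualCutoffProj ∅ M * annulusProj p 1 * scalingUnitary (m * Real.log p))
          ((f i : evenPart) : Lp ℂ 2 (volume : Measure ℝ)) =
        ∑' i, diagCoeff g (dualCutoffProj ∅ M * annulusProj p 1 * scalingUnitary (m * Real.log p))
          ((f' i : evenPart) : Lp ℂ 2 (volume : Measure ℝ)))
    (hW1 : ∀ (M : ℝ) (m : ℤ) (ι : Type)
      (f : HilbertBasis ι ℂ (evenPart : Submodule ℂ (Lp ℂ 2 (volume : Measure ℝ)))),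
      Summable (fun i => ‖diagCoeff g (dualCutoffProj ∅ M * annulusProj p 1 * scalingUnitary (m * Real.log p))
        ((f i : evenPart) : Lp ℂ 2 (volume : Measure ℝ))‖) ∧
      ∑' i, ‖diagCoeff g (dualCutoffProj ∅ M * annulusProj p 1 * scalingUnitary (m * Real.log p))
        ((f i : evenPart) : Lp ℂ 2 (volume : Measure ℝ))‖ ≤ C)
    (hW2 : ∀ (m : ℤ) (ι : Type)
      (f : HilbertBasis ι ℂ (evenPart : Submodule ℂ (Lp ℂ 2 (volume : Measure ℝ)))),
      Tendsto (fun M : ℝ => ∑' i,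
          diagCoeff g (dualCutoffProj ∅ M * annulusProj p 1 * scalingUnitary (m * Real.log p))
            ((f i : evenPart) : Lp ℂ 2 (volume : Measure ℝ)))
        atTop (𝓝 ((Real.log p : ℂ) * g (-(m * Real.log p)))))
    (ι : Type) (b : HilbertBasis ι ℂ (evenPart : Submodule ℂ (Lp ℂ 2 (volume : Measure ℝ)))) :
    (∀ Λ : ℝ, 0 < Λ →
      Summable fun i => diagCoeff g (cutoffR {p} Λ) ((b i : evenPart) : Lp ℂ 2 (volume : Measure ℝ))) ∧
    Tendsto (fun Λ : ℝ =>
        (∑' i, diagCoeff g (cutoffR {p} Λ) ((b i : evenPart) : Lp ℂ 2 (volume : Measure ℝ)))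
          - connesSemilocalGeometricSide {p} Λ g)
      atTop (𝓝 0) := by
  obtain ⟨B, hB⟩ := hg.1.continuous.bounded_above_of_compact_support hg.2
  exact Connes1999_thm_VII_4_rat_at_of_annulusCorrection {p} hg
    (fun ι' f' Λ hΛ => summable_diagCoeff_cutoffCorrection_singleton_of_bound p g hW1 ι' f' hΛ)
    (fun ι' f' => tendsto_tsum_diagCoeff_cutoffCorrection_singleton p hB hW0 hW1 hW2 ι' f') ι b

end Singleton

end Literature.NumberTheory.Connes2026
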